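/-
Copyright (c) 2026 the pub-hodgecm-mathlib formalisation cell (harness21).  Prover seat hodgecm-mathlib-LH4-p07 (g10), Track A «(D-RAM) FOUR-FRAME» squad of crux H413,
helper lane on h413 = stmt-HodgeConjecture-24833 (count-neutral); β-BOARD chair F0P3a-p01 (g37) LEDGER #16 «κ-LINE JUNCTIONS».  2026-09-04.
-/
import Summits.HodgeConjecture.HodgeConjecture.Theorems.F0P3cDyRamLabelledOddGluedOffFootHighG2   -- ★ p861597 (F0P3a-p01 (g37)): `depths_of_mem_stratum_G2_offFoot`; brings ★ p861495 `depths_of_mem_stratum_G1_offFoot`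
import Summits.HodgeConjecture.HodgeConjecture.Theorems.F0P3cDyRamLabelledOddOffLocusShellG3      -- ★ p861708 (LH4-p11 (g9)): `finsum_stratum_G3_shell_eq_zero_offLocus`
import Summits.HodgeConjecture.HodgeConjecture.Theorems.F0P3cDyRamTowerSignRelationsDeep          -- ★ (LH7-p08 (g0)): `normSign_towerSign_eq_of_isElementDatum_of_deep₁∕₂∕₃`
import Summits.HodgeConjecture.HodgeConjecture.Theorems.F0P3cDyRamElementDatumParity              -- ★: `isoceles_of_isElementDatum`, `depth_mod_two_eq_of_isElementDatum`
import Summits.HodgeConjecture.HodgeConjecture.Theorems.F0P3cDyRamStageOneBDefs                   -- ★ DEFS: `mcOfRecord`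
import Summits.HodgeConjecture.HodgeConjecture.Theorems.F0P3cDyRamLabelledOddCountDefs              -- ★ DEFS: `labelledOddCount`, `valueClassLabel`
import HarnessLib

/-!
# Crux `H413`, LH4 «(D-RAM) FOUR-FRAME» road, STAGE 1b (β) — THE κ-LINE JUNCTIONS: the `hR6₁ ∕ hR6₂ ∕ hR6₃` binders of ★ p861863 `restSum_eq_of_rows` from ONE-TOKEN lattice heads

Cell `hodgecm-mathlib` (D-0151), FLOOR 0, crux item H413 = `stmt-HodgeConjecture-24833`, route `HCCMUnconditional`; squad F0∕P3c∕LH4.  THEOREMS ONLY (no `def`, no instance, no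
notation, no `sorry`, default heartbeats); ★-only imports; lane `--supports stmt-HodgeConjecture-24833 --as helper` (count-neutral; pays NO row, states NO law).

WHAT.  F0P3a-p01 (g37)'s ★ p861863 `…OddLabelledRestAssembly.restSum_eq_of_rows` takes the κ-locus rows of the three towers as binders
`hR6ₖ : ∀ ρ s, 1 ≤ ρ → 1 ≤ s → 2 ∣ s → 2ρ + d%2 = cₖ → n_{k'} ≠ cₖ + s → ∀ i, vᵢ(Gₖ(ρ, s)) = κₖ ρ s i` (tower 1: `G₁ = (2ρ, 2ρ+s, 2ρ+s)`, `c₁ = n₂`, read at `n₁`;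
tower 2: `G₂ = (2ρ+s, 2ρ, 2ρ+s)`, `c₂ = n₁`, read at `n₂`; tower 3: `G₃ = (2ρ+s, 2ρ+s, 2ρ)`, `c₃ = n₂`, read at `n₃`), and LH4-p10 (g6)'s ★ p861847 `harith_of_values` wants the
closed forms `κₖ` in the SYMMETRIC-PAIR currency `(ω_A + ω(−1)ω_C, 0, 0)∕4`, `(0, ω_B + ω_C, 0)∕4`, `(0, 0, ω(−1)ω_B + ω(−1)ω_A)∕4` `· q^{2ρ−1+s∕2} · Fₖ`,
`Fₖ = (q−1)[2d + d%2 + 2ρ + s ≤ nₖ] − [nₖ + 2 = 2d + d%2 + 2ρ + s]`.  This file proves the three binders AT THOSE `κₖ` (the `hκk` right-hand sides of ★ p861847 verbatim at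
`q := #𝓀[K]`, `ω_X := normSign σ e_X`, `ω(−1) := normSign σ (−1)`) from: (a) a PER-CLASS LATTICE HEAD in ONE-TOKEN form, carried as a binder on the κ-BRANCH ONLY
(`2ρ + d%2 = cₖ ∧ 2ρ + s + d%2 < nₖ`; tokens `(ω_A, 0, 0)∕2`, `(0, ω_B, 0)∕2`, `(0, 0, ω(−1)ω_B)∕2` — LH4-p11 (g9) R6a ∕ LH4-p08 (g10) R6-DERIVATION, SIG-R6G3-head); (b) the
EMPTY-ABOVE zero off the κ-branch (`nₖ < 2ρ + s + d%2`): towers 1∕2 by ★ `depths_of_mem_stratum_G1∕G2_offFoot` (a member forces `2ρ + s ≤ nₖ`, parity ★ `depth_mod_two_eq_of_isElementDatum`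
closes the seam `nₖ = 2ρ + s`, `d` odd), tower 3 by ★ p861708 `finsum_stratum_G3_shell_eq_zero_offLocus`; there the bracket `Fₖ` is `0` by arithmetic; (c) the ★ deep tower-sign
relations `…TowerSignRelationsDeep.normSign_towerSign_eq_of_isElementDatum_of_deep₁∕₂∕₃` to pass from one token to the symmetric pair — needed exactly when `Fₖ ≠ 0`, which forces
`nₖ ≥ cₖ + s + 2d − 2 > cₖ`, so (★ `isoceles_of_isElementDatum`) the other two depths coincide and the third is deep (`cₖ + 2d ≤ nₖ`).
* §1 `kappaLine_G1_of_rows` · §2 `kappaLine_G2_of_rows` · §3 `kappaLine_G3_of_rows`.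
HONEST LABEL.  Count-neutral junctions; the three lattice heads (a) are HYPOTHESES here (★-pending in other hands); `hRest`, (β) `stub_law_cleanSgn`, T₊ OPEN; `HC_CM` is proved
only modulo the 7 printed citations (2 remaining named inputs: hLiu418 = `stmt-HodgeConjecture-24832`, h413 = `stmt-HodgeConjecture-24833`) until rung 0 closes.

## References
* [Kottwitz1986BaseChangeUnits] R. E. Kottwitz, *Base change for unit elements of Hecke algebras*, Compositio Math. 60 (1986), §1 pp. 240–241 (lattice counts by strata).
* [Rogawski1990] J. D. Rogawski, *Automorphic Representations of Unitary Groups in Three Variables*, Ann. of Math. Stud. 123 (1990), §4.9 Prop. 4.9.1 (a)(b) p. 55.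
* [Serre1979] J.-P. Serre, *Local Fields*, GTM 67 (1979), Ch. V §3 Cor. 3 (norm classes of units in a ramified quadratic extension).
-/

set_option autoImplicit false

noncomputable section

namespace Summit.HodgeConjecture.HodgeConjecture.Cruxes.H413.F0P3cDyRamOddLabelledKappaLines

open Literature.NumberTheory.Automorphic Literature.NumberTheory.Automorphic.HermitianLattice
open Literature.NumberTheory.Automorphic.UnitaryLatticeTree Literature.NumberTheory.Automorphic.UnitaryThreeFourFrame
open Literature.NumberTheory.LocalFields Literature.NumberTheory.LocalFields.WildQuadraticDatum
open Summit.HodgeConjecture.HodgeConjecture.Cruxes.H413.F0P3cDyRamFourFramePieces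
open Summit.HodgeConjecture.HodgeConjecture.Cruxes.H413.F0P3cDyRamFourFrameCensusDefs
open Summit.HodgeConjecture.HodgeConjecture.Cruxes.H413.F0P3cDyRamStageOneBDefs (mcOfRecord)
open Summit.HodgeConjecture.HodgeConjecture.Cruxes.H413.F0P3cDyRamDiagonalTorusDefs
open Summit.HodgeConjecture.HodgeConjecture.Cruxes.H413.F0P3cDyRamDiagonalStrataDefs
open Summit.HodgeConjecture.HodgeConjecture.Cruxes.H413.F0P3cDyRamLabelledOddCountDefs
open Summit.HodgeConjecture.HodgeConjecture.Cruxes.H413.F0P3cDyRamLabelledOddGluedOffFootHigh (depths_of_mem_stratum_G1_offFoot)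
open Summit.HodgeConjecture.HodgeConjecture.Cruxes.H413.F0P3cDyRamLabelledOddGluedOffFootHighG2 (depths_of_mem_stratum_G2_offFoot)
open Summit.HodgeConjecture.HodgeConjecture.Cruxes.H413.F0P3cDyRamLabelledOddOffLocusShellG3 (finsum_stratum_G3_shell_eq_zero_offLocus)
open Summit.HodgeConjecture.HodgeConjecture.Cruxes.H413.F0P3cDyRamTowerSignRelationsDeep
open Summit.HodgeConjecture.HodgeConjecture.Cruxes.H413.F0P3cDyRamElementDatumParity (isoceles_of_isElementDatum depth_mod_two_eq_of_isElementDatum)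
open scoped Valued WithZero Matrix MatrixGroups

variable {K : Type} [Field K] [Valued K ℤᵐ⁰] [CompleteSpace K] [Fintype 𝓀[K]] {σ : K →+* K} {ϖ : K} {d t : ℕ} {α β : K} {N₀ n₁ n₂ n₃ : ℕ}

/-! ## §1  Tower 1: `G₁(ρ, s) = (2ρ, 2ρ+s, 2ρ+s)`, κ-locus `2ρ + d%2 = n₂`, off the foot `n₁ ≠ n₂ + s`, read at `n₁` -/

/-- **THE κ-LINE JUNCTION OF TOWER 1** (= the `hR6₁` binder of ★ p861863 `restSum_eq_of_rows` at `κ₀ :=` ★ p861847's `hκ0` closed form).  At a ramified datum, an element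
datum at `N₀ ≥ d`, `T = diag(α, β, 1)`, tower-sign tokens `e_A` of `α − 1` (depth letter `n₂`) and `e_C` of `β − α` (depth letter `n₃`): IF the per-class lattice head of
tower 1 holds on the κ-branch in one-token form — `2ρ + d%2 = n₂`, `2ρ + s + d%2 < n₁` ⟹ `vᵢ(G₁(ρ,s)) = (ω_A, 0, 0)ᵢ∕2 · q^{2ρ−1+s∕2} · F₁` — THEN for all `ρ, s ≥ 1`, `2 ∣ s`,
`2ρ + d%2 = n₂`, `n₁ ≠ n₂ + s` and every slot `i`: `vᵢ(G₁(ρ,s)) = (ω_A + ω(−1)ω_C, 0, 0)ᵢ∕4 · q^{2ρ−1+s∕2} · F₁`, `F₁ = (q−1)[2d+d%2+2ρ+s ≤ n₁] − [n₁+2 = 2d+d%2+2ρ+s]`.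
Off the branch the stratum is empty (★ `depths_of_mem_stratum_G1_offFoot` + parity) and `F₁ = 0`; on it, `F₁ ≠ 0` forces `n₂ + 2d ≤ n₁`, so `n₂ = n₃` (isosceles) and
★ `…_of_deep₁` gives `ω_C = ω(−1)·ω_A`, i.e. `ω(−1)ω_C = ω_A`. [cite: Kottwitz1986BaseChangeUnits, §1 pp. 240–241] [cite: Rogawski1990, §4.9 Prop. 4.9.1 (a)(b) p. 55]
[cite: Serre1979, Ch. V §3 Cor. 3] -/
theorem kappaLine_G1_of_rows (hD : IsRamifiedQuadraticDatum σ ϖ d t) (hE : IsElementDatum σ ϖ N₀ α β n₁ n₂ n₃) (hdN₀ : d ≤ N₀)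
    (T : GL (Fin 3) K) (hT : (T : Matrix (Fin 3) (Fin 3) K) = Matrix.diagonal ![α, β, 1])
    {eA eC : K} (hσeA : σ eA = eA) (heA1 : Valued.v eA = 1) (hσeC : σ eC = eC)
    (heA : Valued.v ((ϖ ^ mstarOfRecord d)⁻¹ * ((α - 1) * ((ϖ * σ ϖ) ^ ((n₂ - d % 2) / 2))⁻¹ - eA * ((ϖ - σ ϖ) * ((ϖ * σ ϖ) ^ ((d - d % 2) / 2))⁻¹))) ≤ 1)
    (heC : Valued.v ((ϖ ^ mstarOfRecord d)⁻¹ * ((β - α) * ((ϖ * σ ϖ) ^ ((n₃ - d % 2) / 2))⁻¹ - eC * ((ϖ - σ ϖ) * ((ϖ * σ ϖ) ^ ((d - d % 2) / 2))⁻¹))) ≤ 1)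
    (hκ : ∀ (ρ s : ℕ), 1 ≤ ρ → 1 ≤ s → 2 ∣ s → 2 * ρ + d % 2 = n₂ → 2 * ρ + s + d % 2 < n₁ → ∀ i : Fin 3,
      ∑ᶠ M ∈ {M : Submodule 𝒪[K] (Fin 3 → K) | M ∈ stratum σ ϖ T ![2 * ρ, 2 * ρ + s, 2 * ρ + s] ∧
          (LatticeInLevel ϖ (d % 2) (Matrix.diagonal ![α - 1, β - 1, 0]) M ∧ ¬ LatticeInLevel ϖ (d % 2 + 1) (Matrix.diagonal ![α - 1, β - 1, 0]) M ∧
            LatticeInLevel ϖ (mcOfRecord d) (Matrix.diagonal ![(α - 1) * (α - 1), (β - 1) * (β - 1), 0]) M)},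
        (labelledOddCount σ ϖ 0 i (valueClassLabel σ ϖ (α - 1) (β - 1) (mstarOfRecord d) d) M : ℚ) /
          ((((unitStabilizer M).map (unitNormMap σ 3)).relIndex (fixedUnitTorus σ 3) : ℕ) : ℚ) =
        ((![normSign σ eA, 0, 0] : Fin 3 → ℤ) i : ℚ) / 2 * (Fintype.card 𝓀[K] : ℚ) ^ (2 * ρ - 1 + s / 2) *
          ((if 2 * d + d % 2 + 2 * ρ + s ≤ n₁ then (Fintype.card 𝓀[K] : ℚ) - 1 else 0) - (if n₁ + 2 = 2 * d + d % 2 + 2 * ρ + s then 1 else 0))) :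
    ∀ (ρ s : ℕ), 1 ≤ ρ → 1 ≤ s → 2 ∣ s → 2 * ρ + d % 2 = n₂ → n₁ ≠ n₂ + s → ∀ i : Fin 3,
      ∑ᶠ M ∈ {M : Submodule 𝒪[K] (Fin 3 → K) | M ∈ stratum σ ϖ T ![2 * ρ, 2 * ρ + s, 2 * ρ + s] ∧
          (LatticeInLevel ϖ (d % 2) (Matrix.diagonal ![α - 1, β - 1, 0]) M ∧ ¬ LatticeInLevel ϖ (d % 2 + 1) (Matrix.diagonal ![α - 1, β - 1, 0]) M ∧
            LatticeInLevel ϖ (mcOfRecord d) (Matrix.diagonal ![(α - 1) * (α - 1), (β - 1) * (β - 1), 0]) M)},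
        (labelledOddCount σ ϖ 0 i (valueClassLabel σ ϖ (α - 1) (β - 1) (mstarOfRecord d) d) M : ℚ) /
          ((((unitStabilizer M).map (unitNormMap σ 3)).relIndex (fixedUnitTorus σ 3) : ℕ) : ℚ) =
        (![(normSign σ eA : ℚ) + (normSign σ (-1 : K) : ℚ) * (normSign σ eC : ℚ), 0, 0] : Fin 3 → ℚ) i / 4 *
          (Fintype.card 𝓀[K] : ℚ) ^ (2 * ρ - 1 + s / 2) *
          ((if 2 * d + d % 2 + 2 * ρ + s ≤ n₁ then (Fintype.card 𝓀[K] : ℚ) - 1 else 0) - (if n₁ + 2 = 2 * d + d % 2 + 2 * ρ + s then 1 else 0)) := by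
  intro ρ s hρ hs h2s hloc hfoot i
  obtain ⟨hp1, hp2, -⟩ := depth_mod_two_eq_of_isElementDatum hD hE hdN₀
  have hd1 : 1 ≤ d := hD.2.2.2.2.2.1
  rcases Nat.lt_or_gt_of_ne (show n₁ ≠ 2 * ρ + s + d % 2 by omega) with hlt | hgt
  · -- off the κ-branch: the stratum is EMPTY (a member would sit at `2ρ + s ≤ n₁ < 2ρ + s + d%2`, against parity) and `F₁ = 0`
    have hempty : {M : Submodule 𝒪[K] (Fin 3 → K) | M ∈ stratum σ ϖ T ![2 * ρ, 2 * ρ + s, 2 * ρ + s] ∧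
        (LatticeInLevel ϖ (d % 2) (Matrix.diagonal ![α - 1, β - 1, 0]) M ∧ ¬ LatticeInLevel ϖ (d % 2 + 1) (Matrix.diagonal ![α - 1, β - 1, 0]) M ∧
          LatticeInLevel ϖ (mcOfRecord d) (Matrix.diagonal ![(α - 1) * (α - 1), (β - 1) * (β - 1), 0]) M)} = ∅ := by
      refine Set.eq_empty_iff_forall_notMem.2 fun M hM => ?_
      obtain ⟨h1, -, -⟩ := depths_of_mem_stratum_G1_offFoot hD hE T hT hρ hs hfoot hM.1
      omega
    rw [hempty, finsum_mem_empty, if_neg (by omega), if_neg (by omega), sub_zero, mul_zero]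
  · -- on the κ-branch: the one-token head, then one token ↦ the symmetric pair
    rw [hκ ρ s hρ hs h2s hloc hgt i]
    by_cases hdeep : n₂ + 2 * d ≤ n₁
    · -- deep: `n₂ = n₃` by isosceles, RELATION III gives `ω_C = ω(−1)·ω_A`
      have h23 : n₂ = n₃ := by
        rcases isoceles_of_isElementDatum hD hE with ⟨h, -⟩ | ⟨-, h⟩ | ⟨h, -⟩ <;> omega
      have hrel := normSign_towerSign_eq_of_isElementDatum_of_deep₁ hD hE h23 hdeep hp2 hσeA heA1 hσeC heA heC
      have hmm : normSign σ (-1 : K) * normSign σ (-1 : K) = 1 := by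
        unfold normSign
        split_ifs <;> norm_num
      have hZ : normSign σ (-1 : K) * normSign σ eC = normSign σ eA := by
        rw [hrel, ← mul_assoc, hmm, one_mul]
      have hQ : (normSign σ (-1 : K) : ℚ) * (normSign σ eC : ℚ) = (normSign σ eA : ℚ) := by exact_mod_cast hZ
      have key : ∀ j : Fin 3, ((![normSign σ eA, 0, 0] : Fin 3 → ℤ) j : ℚ) / 2 =
          (![(normSign σ eA : ℚ) + (normSign σ (-1 : K) : ℚ) * (normSign σ eC : ℚ), 0, 0] : Fin 3 → ℚ) j / 4 := by
        intro j
        rw [hQ]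
        fin_cases j <;> simp only [Fin.zero_eta, Fin.isValue, Fin.mk_one, Fin.reduceFinMk, Matrix.cons_val_zero, Matrix.cons_val_one,
          Matrix.cons_val_two, Matrix.head_cons, Matrix.tail_cons, Int.cast_zero] <;> ring
      rw [key]
    · -- shallow: both brackets vanish on both sides
      rw [if_neg (by omega), if_neg (by omega), sub_zero, mul_zero, mul_zero]

/-! ## §2  Tower 2: `G₂(ρ, s) = (2ρ+s, 2ρ, 2ρ+s)`, κ-locus `2ρ + d%2 = n₁`, off the foot `n₂ ≠ n₁ + s`, read at `n₂` -/

/-- **THE κ-LINE JUNCTION OF TOWER 2** (= the `hR6₂` binder of ★ p861863 `restSum_eq_of_rows` at `κ₁ :=` ★ p861847's `hκ1` closed form).  At a ramified datum, an element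
datum at `N₀ ≥ d`, `T = diag(α, β, 1)`, tower-sign tokens `e_B` of `β − 1` (depth letter `n₁`) and `e_C` of `β − α` (depth letter `n₃`): IF the per-class lattice head of
tower 2 holds on the κ-branch in one-token form — `2ρ + d%2 = n₁`, `2ρ + s + d%2 < n₂` ⟹ `vᵢ(G₂(ρ,s)) = (0, ω_B, 0)ᵢ∕2 · q^{2ρ−1+s∕2} · F₂` — THEN for all `ρ, s ≥ 1`, `2 ∣ s`,
`2ρ + d%2 = n₁`, `n₂ ≠ n₁ + s` and every slot `i`: `vᵢ(G₂(ρ,s)) = (0, ω_B + ω_C, 0)ᵢ∕4 · q^{2ρ−1+s∕2} · F₂`, `F₂ = (q−1)[2d+d%2+2ρ+s ≤ n₂] − [n₂+2 = 2d+d%2+2ρ+s]`.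
Off the branch the stratum is empty (★ `depths_of_mem_stratum_G2_offFoot` + parity) and `F₂ = 0`; on it, `F₂ ≠ 0` forces `n₁ + 2d ≤ n₂`, so `n₁ = n₃` (isosceles) and
★ `…_of_deep₂` gives `ω_C = ω_B`. [cite: Kottwitz1986BaseChangeUnits, §1 pp. 240–241] [cite: Rogawski1990, §4.9 Prop. 4.9.1 (a)(b) p. 55] [cite: Serre1979, Ch. V §3 Cor. 3] -/
theorem kappaLine_G2_of_rows (hD : IsRamifiedQuadraticDatum σ ϖ d t) (hE : IsElementDatum σ ϖ N₀ α β n₁ n₂ n₃) (hdN₀ : d ≤ N₀)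
    (T : GL (Fin 3) K) (hT : (T : Matrix (Fin 3) (Fin 3) K) = Matrix.diagonal ![α, β, 1])
    {eB eC : K} (hσeB : σ eB = eB) (hσeC : σ eC = eC) (heC1 : Valued.v eC = 1)
    (heB : Valued.v ((ϖ ^ mstarOfRecord d)⁻¹ * ((β - 1) * ((ϖ * σ ϖ) ^ ((n₁ - d % 2) / 2))⁻¹ - eB * ((ϖ - σ ϖ) * ((ϖ * σ ϖ) ^ ((d - d % 2) / 2))⁻¹))) ≤ 1)
    (heC : Valued.v ((ϖ ^ mstarOfRecord d)⁻¹ * ((β - α) * ((ϖ * σ ϖ) ^ ((n₃ - d % 2) / 2))⁻¹ - eC * ((ϖ - σ ϖ) * ((ϖ * σ ϖ) ^ ((d - d % 2) / 2))⁻¹))) ≤ 1)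
    (hκ : ∀ (ρ s : ℕ), 1 ≤ ρ → 1 ≤ s → 2 ∣ s → 2 * ρ + d % 2 = n₁ → 2 * ρ + s + d % 2 < n₂ → ∀ i : Fin 3,
      ∑ᶠ M ∈ {M : Submodule 𝒪[K] (Fin 3 → K) | M ∈ stratum σ ϖ T ![2 * ρ + s, 2 * ρ, 2 * ρ + s] ∧
          (LatticeInLevel ϖ (d % 2) (Matrix.diagonal ![α - 1, β - 1, 0]) M ∧ ¬ LatticeInLevel ϖ (d % 2 + 1) (Matrix.diagonal ![α - 1, β - 1, 0]) M ∧
            LatticeInLevel ϖ (mcOfRecord d) (Matrix.diagonal ![(α - 1) * (α - 1), (β - 1) * (β - 1), 0]) M)},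
        (labelledOddCount σ ϖ 0 i (valueClassLabel σ ϖ (α - 1) (β - 1) (mstarOfRecord d) d) M : ℚ) /
          ((((unitStabilizer M).map (unitNormMap σ 3)).relIndex (fixedUnitTorus σ 3) : ℕ) : ℚ) =
        ((![0, normSign σ eB, 0] : Fin 3 → ℤ) i : ℚ) / 2 * (Fintype.card 𝓀[K] : ℚ) ^ (2 * ρ - 1 + s / 2) *
          ((if 2 * d + d % 2 + 2 * ρ + s ≤ n₂ then (Fintype.card 𝓀[K] : ℚ) - 1 else 0) - (if n₂ + 2 = 2 * d + d % 2 + 2 * ρ + s then 1 else 0))) :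
    ∀ (ρ s : ℕ), 1 ≤ ρ → 1 ≤ s → 2 ∣ s → 2 * ρ + d % 2 = n₁ → n₂ ≠ n₁ + s → ∀ i : Fin 3,
      ∑ᶠ M ∈ {M : Submodule 𝒪[K] (Fin 3 → K) | M ∈ stratum σ ϖ T ![2 * ρ + s, 2 * ρ, 2 * ρ + s] ∧
          (LatticeInLevel ϖ (d % 2) (Matrix.diagonal ![α - 1, β - 1, 0]) M ∧ ¬ LatticeInLevel ϖ (d % 2 + 1) (Matrix.diagonal ![α - 1, β - 1, 0]) M ∧
            LatticeInLevel ϖ (mcOfRecord d) (Matrix.diagonal ![(α - 1) * (α - 1), (β - 1) * (β - 1), 0]) M)},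
        (labelledOddCount σ ϖ 0 i (valueClassLabel σ ϖ (α - 1) (β - 1) (mstarOfRecord d) d) M : ℚ) /
          ((((unitStabilizer M).map (unitNormMap σ 3)).relIndex (fixedUnitTorus σ 3) : ℕ) : ℚ) =
        (![(0 : ℚ), (normSign σ eB : ℚ) + (normSign σ eC : ℚ), 0] : Fin 3 → ℚ) i / 4 *
          (Fintype.card 𝓀[K] : ℚ) ^ (2 * ρ - 1 + s / 2) *
          ((if 2 * d + d % 2 + 2 * ρ + s ≤ n₂ then (Fintype.card 𝓀[K] : ℚ) - 1 else 0) - (if n₂ + 2 = 2 * d + d % 2 + 2 * ρ + s then 1 else 0)) := by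
  intro ρ s hρ hs h2s hloc hfoot i
  obtain ⟨hp1, hp2, -⟩ := depth_mod_two_eq_of_isElementDatum hD hE hdN₀
  have hd1 : 1 ≤ d := hD.2.2.2.2.2.1
  rcases Nat.lt_or_gt_of_ne (show n₂ ≠ 2 * ρ + s + d % 2 by omega) with hlt | hgt
  · -- off the κ-branch: the stratum is EMPTY and `F₂ = 0`
    have hempty : {M : Submodule 𝒪[K] (Fin 3 → K) | M ∈ stratum σ ϖ T ![2 * ρ + s, 2 * ρ, 2 * ρ + s] ∧
        (LatticeInLevel ϖ (d % 2) (Matrix.diagonal ![α - 1, β - 1, 0]) M ∧ ¬ LatticeInLevel ϖ (d % 2 + 1) (Matrix.diagonal ![α - 1, β - 1, 0]) M ∧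
          LatticeInLevel ϖ (mcOfRecord d) (Matrix.diagonal ![(α - 1) * (α - 1), (β - 1) * (β - 1), 0]) M)} = ∅ := by
      refine Set.eq_empty_iff_forall_notMem.2 fun M hM => ?_
      obtain ⟨h1, -, -⟩ := depths_of_mem_stratum_G2_offFoot hD hE T hT hρ hs hfoot hM.1
      omega
    rw [hempty, finsum_mem_empty, if_neg (by omega), if_neg (by omega), sub_zero, mul_zero]
  · -- on the κ-branch: the one-token head, then one token ↦ the symmetric pair
    rw [hκ ρ s hρ hs h2s hloc hgt i]
    by_cases hdeep : n₁ + 2 * d ≤ n₂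
    · -- deep: `n₁ = n₃` by isosceles, RELATION II gives `ω_C = ω_B`
      have h13 : n₁ = n₃ := by
        rcases isoceles_of_isElementDatum hD hE with ⟨h, -⟩ | ⟨h, -⟩ | ⟨-, h⟩ <;> omega
      have hrel := normSign_towerSign_eq_of_isElementDatum_of_deep₂ hD hE h13 hdeep hp1 hσeB hσeC heC1 heB heC
      have key : ∀ j : Fin 3, ((![0, normSign σ eB, 0] : Fin 3 → ℤ) j : ℚ) / 2 =
          (![(0 : ℚ), (normSign σ eB : ℚ) + (normSign σ eC : ℚ), 0] : Fin 3 → ℚ) j / 4 := by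
        intro j
        rw [hrel]
        fin_cases j <;> simp only [Fin.zero_eta, Fin.isValue, Fin.mk_one, Fin.reduceFinMk, Matrix.cons_val_zero, Matrix.cons_val_one,
          Matrix.cons_val_two, Matrix.head_cons, Matrix.tail_cons, Int.cast_zero] <;> ring
      rw [key]
    · -- shallow: both brackets vanish on both sides
      rw [if_neg (by omega), if_neg (by omega), sub_zero, mul_zero, mul_zero]

/-! ## §3  Tower 3: `G₃(ρ, s) = (2ρ+s, 2ρ+s, 2ρ)`, κ-locus `2ρ + d%2 = n₂`, off the foot `n₃ ≠ n₂ + s`, read at `n₃` -/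

/-- **THE κ-LINE JUNCTION OF TOWER 3** (= the `hR6₃` binder of ★ p861863 `restSum_eq_of_rows` at `κ₂ :=` ★ p861847's `hκ2` closed form).  At a ramified datum, an element
datum at `N₀ ≥ d, mcOfRecord d`, any `T`, tower-sign tokens `e_A` of `α − 1` (depth letter `n₂`) and `e_B` of `β − 1` (depth letter `n₁`): IF the per-class lattice head of
tower 3 holds on the κ-branch in one-token form — `2ρ + d%2 = n₂`, `2ρ + s + d%2 < n₃` ⟹ `vᵢ(G₃(ρ,s)) = (0, 0, ω(−1)ω_B)ᵢ∕2 · q^{2ρ−1+s∕2} · F₃` (LH4-p08 (g10) R6-DERIVATION,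
SIG-R6G3-head) — THEN for all `ρ, s ≥ 1`, `2 ∣ s`, `2ρ + d%2 = n₂`, `n₃ ≠ n₂ + s` and every slot `i`: `vᵢ(G₃(ρ,s)) = (0, 0, ω(−1)ω_B + ω(−1)ω_A)ᵢ∕4 · q^{2ρ−1+s∕2} · F₃`,
`F₃ = (q−1)[2d+d%2+2ρ+s ≤ n₃] − [n₃+2 = 2d+d%2+2ρ+s]`.  Off the branch the row is ★ p861708's off-locus zero and `F₃ = 0`; on it, `F₃ ≠ 0` forces `n₂ + 2d ≤ n₃`, so `n₁ = n₂`
(isosceles) and ★ `…_of_deep₃` gives `ω_B = ω_A`. [cite: Kottwitz1986BaseChangeUnits, §1 pp. 240–241] [cite: Rogawski1990, §4.9 Prop. 4.9.1 (a)(b) p. 55] [cite: Serre1979, Ch. V §3 Cor. 3] -/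
theorem kappaLine_G3_of_rows (hD : IsRamifiedQuadraticDatum σ ϖ d t) (hE : IsElementDatum σ ϖ N₀ α β n₁ n₂ n₃) (hdN₀ : d ≤ N₀) (hmc : mcOfRecord d ≤ N₀)
    (T : GL (Fin 3) K)
    {eA eB : K} (hσeA : σ eA = eA) (heA1 : Valued.v eA = 1) (hσeB : σ eB = eB)
    (heA : Valued.v ((ϖ ^ mstarOfRecord d)⁻¹ * ((α - 1) * ((ϖ * σ ϖ) ^ ((n₂ - d % 2) / 2))⁻¹ - eA * ((ϖ - σ ϖ) * ((ϖ * σ ϖ) ^ ((d - d % 2) / 2))⁻¹))) ≤ 1)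
    (heB : Valued.v ((ϖ ^ mstarOfRecord d)⁻¹ * ((β - 1) * ((ϖ * σ ϖ) ^ ((n₁ - d % 2) / 2))⁻¹ - eB * ((ϖ - σ ϖ) * ((ϖ * σ ϖ) ^ ((d - d % 2) / 2))⁻¹))) ≤ 1)
    (hκ : ∀ (ρ s : ℕ), 1 ≤ ρ → 1 ≤ s → 2 ∣ s → 2 * ρ + d % 2 = n₂ → 2 * ρ + s + d % 2 < n₃ → ∀ i : Fin 3,
      ∑ᶠ M ∈ {M : Submodule 𝒪[K] (Fin 3 → K) | M ∈ stratum σ ϖ T ![2 * ρ + s, 2 * ρ + s, 2 * ρ] ∧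
          (LatticeInLevel ϖ (d % 2) (Matrix.diagonal ![α - 1, β - 1, 0]) M ∧ ¬ LatticeInLevel ϖ (d % 2 + 1) (Matrix.diagonal ![α - 1, β - 1, 0]) M ∧
            LatticeInLevel ϖ (mcOfRecord d) (Matrix.diagonal ![(α - 1) * (α - 1), (β - 1) * (β - 1), 0]) M)},
        (labelledOddCount σ ϖ 0 i (valueClassLabel σ ϖ (α - 1) (β - 1) (mstarOfRecord d) d) M : ℚ) /
          ((((unitStabilizer M).map (unitNormMap σ 3)).relIndex (fixedUnitTorus σ 3) : ℕ) : ℚ) =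
        ((![0, 0, normSign σ (-1 : K) * normSign σ eB] : Fin 3 → ℤ) i : ℚ) / 2 * (Fintype.card 𝓀[K] : ℚ) ^ (2 * ρ - 1 + s / 2) *
          ((if 2 * d + d % 2 + 2 * ρ + s ≤ n₃ then (Fintype.card 𝓀[K] : ℚ) - 1 else 0) - (if n₃ + 2 = 2 * d + d % 2 + 2 * ρ + s then 1 else 0))) :
    ∀ (ρ s : ℕ), 1 ≤ ρ → 1 ≤ s → 2 ∣ s → 2 * ρ + d % 2 = n₂ → n₃ ≠ n₂ + s → ∀ i : Fin 3,
      ∑ᶠ M ∈ {M : Submodule 𝒪[K] (Fin 3 → K) | M ∈ stratum σ ϖ T ![2 * ρ + s, 2 * ρ + s, 2 * ρ] ∧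
          (LatticeInLevel ϖ (d % 2) (Matrix.diagonal ![α - 1, β - 1, 0]) M ∧ ¬ LatticeInLevel ϖ (d % 2 + 1) (Matrix.diagonal ![α - 1, β - 1, 0]) M ∧
            LatticeInLevel ϖ (mcOfRecord d) (Matrix.diagonal ![(α - 1) * (α - 1), (β - 1) * (β - 1), 0]) M)},
        (labelledOddCount σ ϖ 0 i (valueClassLabel σ ϖ (α - 1) (β - 1) (mstarOfRecord d) d) M : ℚ) /
          ((((unitStabilizer M).map (unitNormMap σ 3)).relIndex (fixedUnitTorus σ 3) : ℕ) : ℚ) =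
        (![(0 : ℚ), 0, (normSign σ (-1 : K) : ℚ) * (normSign σ eB : ℚ) + (normSign σ (-1 : K) : ℚ) * (normSign σ eA : ℚ)] : Fin 3 → ℚ) i / 4 *
          (Fintype.card 𝓀[K] : ℚ) ^ (2 * ρ - 1 + s / 2) *
          ((if 2 * d + d % 2 + 2 * ρ + s ≤ n₃ then (Fintype.card 𝓀[K] : ℚ) - 1 else 0) - (if n₃ + 2 = 2 * d + d % 2 + 2 * ρ + s then 1 else 0)) := by
  intro ρ s hρ hs h2s hloc hfoot i
  obtain ⟨hp1, -, -⟩ := depth_mod_two_eq_of_isElementDatum hD hE hdN₀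
  have hd1 : 1 ≤ d := hD.2.2.2.2.2.1
  rcases Nat.lt_or_gt_of_ne (show n₃ ≠ 2 * ρ + s + d % 2 by omega) with hlt | hgt
  · -- off the κ-branch: ★ p861708's off-locus zero (neither read nor κ-branch) and `F₃ = 0`
    have hz : ∑ᶠ M ∈ {M : Submodule 𝒪[K] (Fin 3 → K) | M ∈ stratum σ ϖ T ![2 * ρ + s, 2 * ρ + s, 2 * ρ] ∧
        (LatticeInLevel ϖ (d % 2) (Matrix.diagonal ![α - 1, β - 1, 0]) M ∧ ¬ LatticeInLevel ϖ (d % 2 + 1) (Matrix.diagonal ![α - 1, β - 1, 0]) M ∧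
          LatticeInLevel ϖ (mcOfRecord d) (Matrix.diagonal ![(α - 1) * (α - 1), (β - 1) * (β - 1), 0]) M)},
        (labelledOddCount σ ϖ 0 i (valueClassLabel σ ϖ (α - 1) (β - 1) (mstarOfRecord d) d) M : ℚ) /
          ((((unitStabilizer M).map (unitNormMap σ 3)).relIndex (fixedUnitTorus σ 3) : ℕ) : ℚ) = 0 :=
      finsum_stratum_G3_shell_eq_zero_offLocus hD hE hmc T ρ s hρ hs hfoot (by omega) (by omega) _ _ i
    rw [hz, if_neg (by omega), if_neg (by omega), sub_zero, mul_zero]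
  · -- on the κ-branch: the one-token head, then one token ↦ the symmetric pair
    rw [hκ ρ s hρ hs h2s hloc hgt i]
    by_cases hdeep : n₂ + 2 * d ≤ n₃
    · -- deep: `n₁ = n₂` by isosceles, RELATION I gives `ω_B = ω_A`
      have h12 : n₁ = n₂ := by
        rcases isoceles_of_isElementDatum hD hE with ⟨h, -⟩ | ⟨h, h'⟩ | ⟨h, h'⟩ <;> omega
      have hrel := normSign_towerSign_eq_of_isElementDatum_of_deep₃ hD hE h12 (by omega) hp1 hσeA heA1 hσeB heA heB
      have key : ∀ j : Fin 3, ((![0, 0, normSign σ (-1 : K) * normSign σ eB] : Fin 3 → ℤ) j : ℚ) / 2 =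
          (![(0 : ℚ), 0, (normSign σ (-1 : K) : ℚ) * (normSign σ eB : ℚ) + (normSign σ (-1 : K) : ℚ) * (normSign σ eA : ℚ)] : Fin 3 → ℚ) j / 4 := by
        intro j
        rw [hrel]
        fin_cases j <;> simp only [Fin.zero_eta, Fin.isValue, Fin.mk_one, Fin.reduceFinMk, Matrix.cons_val_zero, Matrix.cons_val_one,
          Matrix.cons_val_two, Matrix.head_cons, Matrix.tail_cons, Int.cast_zero, Int.cast_mul] <;> ring
      rw [key]
    · -- shallow: both brackets vanish on both sides
      rw [if_neg (by omega), if_neg (by omega), sub_zero, mul_zero, mul_zero]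

end Summit.HodgeConjecture.HodgeConjecture.Cruxes.H413.F0P3cDyRamOddLabelledKappaLines

end
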